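import Summits.ResolutionOfSingularities.KangarooAtlas.MizutaniLemma29Heat
import Summits.ResolutionOfSingularities.KangarooAtlas.MizutaniWaveKernel
import HarnessLib

/-!
# Mizutani's Lemma 2.9 (2) — the case of a non-degenerate symbol: `dim_L ker D ≤ 2p − 1`

Cell topic `Summits/ResolutionOfSingularities/KangarooAtlas` (pub-rosobs); namespace
`Summit.ResolutionOfSingularities.KangarooAtlas.Mizutani`.  Part of the Lean transcription of Mizutani 1973 §2
around the in-house note MIZUTANI-PROOF-g59 (AI-written, AI-audited; *AI review is weaker than expert review*; not a
resolution theorem).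

Setting of Lemma 2.9 in tower form (`h : IsRootTower L K p x a`, `p ≠ 2`, `D` of order `≤ 2` with
`D 1 = D a₀ = D a₁ = 0`), in the case `γ = D(a₁²) ≠ 0` and `D(a₀²)γ ≠ D(a₀a₁)²` (the symbol
`αξ₀² + 2βξ₀ξ₁ + γξ₁²` is NOT a square).  With `β' = β/γ`, `α' = α/γ`, `δ = α' − β'² ≠ 0`:
`D = (γ/2)·E`, `E = ∂₁∂₁ + 2β'∂₀∂₁ + α'∂₀∂₀`; after base change (`E^♯`, `MizutaniSharp`) and the linear substitution
`δ₀ = u + β'σ` (`MizutaniBoxSubst`) the operator becomes `∂σ² + δ∂u² + (higher order)`, whose kernel has dimension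
`≤ 2p − 1` (`finrank_ker_wavePert_le`).  Hence **`IsRootTower.finrank_ker_le_of_not_sq`: `dim_L ker D ≤ 2p − 1`**
— Mizutani's «`(a² − 4b) = 0`» (p. 94), obtained here by initial forms instead of his matrix computation.

References: [Mizutani1973HironakaGroupSchemes] Lemma 2.9 (2), p. 93–94.
-/

open MvPolynomial TensorProduct Literature.AlgebraicGeometry.Resolution

namespace Summit.ResolutionOfSingularities.KangarooAtlas.Mizutani

universe u

section Wave

variable {L K : Type u} [Field L] [Field K] [Algebra L K] {p : ℕ} [hp : Fact p.Prime] [CharP K p]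
  {x : Fin 2 → L} {a : Fin 2 → K}

/-- **The conjugation identity, non-degenerate case**: for `E = ∂₁∂₁ + c₁·∂₀∂₁ + c₂·∂₀∂₀` on `K` (`c₁, c₂ ∈ K`) and
`θ̄ = substQ b 0`, `θ̄ (E^♯ y) = wavePert r ρ (θ̄ y)` with `r = θ̄(tau c₁) − 2b`, `ρ = b² − b·θ̄(tau c₁) + θ̄(tau c₂)`.
[cite: Mizutani1973HironakaGroupSchemes, Lemma 2.9 (2) (proof outline)] -/
theorem IsRootTower.substQ_sharp_wave (h : IsRootTower L K (p ^ 1) x a) (b c₁ c₂ : K) (y : BoxQuot (Fin 2) K (p ^ 1)) :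
    let E : K →ₗ[L] K := h.hsD (Finsupp.single 1 1) ∘ₗ h.hsD (Finsupp.single 1 1) +
      c₁ • (h.hsD (Finsupp.single 0 1) ∘ₗ h.hsD (Finsupp.single 1 1)) +
      c₂ • (h.hsD (Finsupp.single 0 1) ∘ₗ h.hsD (Finsupp.single 0 1))
    let r := substQ K b 0 (h.tau c₁) - 2 * Ideal.Quotient.mk _ (C b)
    let ρ := Ideal.Quotient.mk _ (C b) * Ideal.Quotient.mk _ (C b) - Ideal.Quotient.mk _ (C b) * substQ K b 0 (h.tau c₁) +
      substQ K b 0 (h.tau c₂)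
    substQ K b 0 (h.sharp E y) = wavePert K p r ρ (substQ K b 0 y) := by
  intro E r ρ
  set θ := substQ K b 0 with hθ
  set d0 := boxDeriv K 2 (p ^ 1) 0 with hd0
  set d1 := boxDeriv K 2 (p ^ 1) 1 with hd1
  have hE : ∀ z, h.sharp E z = d1 (d1 z) + h.tau c₁ * d0 (d1 z) + h.tau c₂ * d0 (d0 z) := by
    intro z
    show h.sharp (h.hsD (Finsupp.single 1 1) ∘ₗ h.hsD (Finsupp.single 1 1) +
      c₁ • (h.hsD (Finsupp.single 0 1) ∘ₗ h.hsD (Finsupp.single 1 1)) +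
      c₂ • (h.hsD (Finsupp.single 0 1) ∘ₗ h.hsD (Finsupp.single 0 1))) z = _
    rw [h.sharp_add, h.sharp_add, LinearMap.add_apply, LinearMap.add_apply, h.sharp_smul, h.sharp_smul, h.sharp_comp,
      h.sharp_comp, h.sharp_comp, LinearMap.comp_apply, LinearMap.comp_apply, LinearMap.comp_apply,
      h.sharp_hsD_single le_rfl, h.sharp_hsD_single le_rfl]
  have hg : Ideal.Quotient.mk (boxIdeal (Fin 2) K (p ^ 1)) (C b + C (2 * (0 : K)) * X 1) = Ideal.Quotient.mk _ (C b) := by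
    rw [mul_zero, C_0, zero_mul, add_zero]
  -- `θ` and the derivatives
  have hθ0 : ∀ z, θ (d0 z) = d0 (θ z) := fun z => (boxDeriv_zero_substQ b 0 z).symm
  have hθ1 : ∀ z, θ (d1 z) = d1 (θ z) - Ideal.Quotient.mk _ (C b) * d0 (θ z) := by
    intro z
    have h1 := boxDeriv_one_substQ b 0 z
    rw [hg] at h1
    rw [← hθ, ← hd0, ← hd1] at h1
    rw [h1, hθ0]; ring
  have hC0 : ∀ v, d0 (Ideal.Quotient.mk _ (C b) * v) = Ideal.Quotient.mk _ (C b) * d0 v := fun v => boxDeriv_C_mul le_rfl 0 b v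
  have hC1 : ∀ v, d1 (Ideal.Quotient.mk _ (C b) * v) = Ideal.Quotient.mk _ (C b) * d1 v := fun v => boxDeriv_C_mul le_rfl 1 b v
  have hcomm : ∀ v, d1 (d0 v) = d0 (d1 v) := fun v => boxDeriv_comm 1 0 v
  have hrdef : r = θ (h.tau c₁) - 2 * Ideal.Quotient.mk _ (C b) := rfl
  have hρdef : ρ = Ideal.Quotient.mk _ (C b) * Ideal.Quotient.mk _ (C b) - Ideal.Quotient.mk _ (C b) * θ (h.tau c₁) +
      θ (h.tau c₂) := rfl
  rw [hE]
  simp only [map_add, map_sub, map_mul, hθ1, hθ0, hC1, hC0]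
  rw [hcomm, wavePert_apply, hrdef, hρdef]
  ring

/-- **Case (iii) of Lemma 2.9 (2), ⇒: a NON-square symbol forces `dim_L ker D ≤ 2p − 1`** (`< 2p`).
[cite: Mizutani1973HironakaGroupSchemes, Lemma 2.9 (2) (proof outline, p. 94: «(a² − 4b) = 0, hence b = (a/2)²»)] -/
theorem IsRootTower.finrank_ker_le_of_not_sq (h : IsRootTower L K (p ^ 1) x a) (hp2 : p ≠ 2)
    {D : K →ₗ[L] K} (hD : IsDiffOpLE L 2 D) (h1 : D 1 = 0) (ha : ∀ i, D (a i) = 0) (hγ : D (a 1 ^ 2) ≠ 0)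
    (hnsq : D (a 0 ^ 2) * D (a 1 ^ 2) ≠ D (a 0 * a 1) ^ 2) :
    Module.finrank L (LinearMap.ker D) ≤ 2 * p - 1 := by
  haveI := h.finiteDimensional
  have h2 : (2 : K) ≠ 0 := two_ne_zero_of_ne_two hp2
  set α := D (a 0 ^ 2) with hα
  set β := D (a 0 * a 1) with hβ
  set γ := D (a 1 ^ 2) with hγ'
  set β' : K := β / γ with hβ'
  set α' : K := α / γ with hα'
  set δ : K := α' - β' ^ 2 with hδ
  have hδ0 : δ ≠ 0 := by
    intro h0
    apply hnsq
    have : α' = β' ^ 2 := sub_eq_zero.mp h0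
    rw [hα', hβ', div_pow, div_eq_iff hγ, div_mul_eq_mul_div, eq_div_iff (pow_ne_zero 2 hγ)] at this
    calc α * γ = α * γ ^ 2 / γ := by rw [pow_two, ← mul_assoc, mul_div_cancel_right₀ _ hγ]
      _ = β ^ 2 := by rw [this, mul_div_cancel_right₀ _ hγ]
  set d0K := h.hsD (Finsupp.single 0 1) with hd0K
  set d1K := h.hsD (Finsupp.single 1 1) with hd1K
  set E : K →ₗ[L] K := d1K ∘ₗ d1K + (2 * β') • (d0K ∘ₗ d1K) + α' • (d0K ∘ₗ d0K) with hE
  -- `D = (γ/2) · E`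
  have hDE : D = (γ / 2) • E := by
    have key := h.eq_three_of_isDiffOpLE_two hp2 hD h1 ha
    rw [← hα, ← hβ, ← hγ'] at key
    have h20 : h.hsD (Finsupp.single 0 2) = (2 : K)⁻¹ • (d0K ∘ₗ d0K) := by
      rw [hd0K, h.hsD_single_one_comp_self, smul_smul, inv_mul_cancel₀ h2, one_smul]
    have h02 : h.hsD (Finsupp.single 1 2) = (2 : K)⁻¹ • (d1K ∘ₗ d1K) := by
      rw [hd1K, h.hsD_single_one_comp_self, smul_smul, inv_mul_cancel₀ h2, one_smul]
    have h11 : h.hsD (Finsupp.single 0 1 + Finsupp.single 1 1) = d0K ∘ₗ d1K :=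
      (h.hsD_single_comp_single 0 1 (by decide)).symm
    conv_lhs => rw [key]
    rw [h20, h02, h11, hE]
    ext y
    simp only [LinearMap.add_apply, LinearMap.smul_apply, LinearMap.comp_apply, smul_eq_mul]
    rw [hα', hβ']
    field_simp
    ring
  have hker : LinearMap.ker D = LinearMap.ker E := by
    rw [hDE]
    ext y
    simp only [LinearMap.mem_ker, LinearMap.smul_apply, smul_eq_mul, mul_eq_zero, div_eq_zero_iff, hγ, h2, or_self,
      false_or]
  rw [hker]
  refine le_trans (h.finrank_ker_le_finrank_ker_sharp E) ?_
  -- conjugate by the linear substitution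
  set θ := substEquiv K β' 0 with hθ
  set r := substQ K β' 0 (h.tau (2 * β')) - 2 * Ideal.Quotient.mk _ (C β') with hr
  set ρ := Ideal.Quotient.mk _ (C β') * Ideal.Quotient.mk _ (C β') - Ideal.Quotient.mk _ (C β') * substQ K β' 0 (h.tau (2 * β')) +
    substQ K β' 0 (h.tau α') with hρ
  have hkerP : LinearMap.ker (wavePert K p r ρ) = (LinearMap.ker (h.sharp E)).map θ.toLinearEquiv.toLinearMap := by
    ext z
    rw [LinearMap.mem_ker, Submodule.mem_map_equiv, LinearMap.mem_ker]
    have hz : z = substQ K β' 0 (θ.toLinearEquiv.symm z) := by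
      show z = θ (θ.symm z)
      rw [AlgEquiv.apply_symm_apply]
    have key := h.substQ_sharp_wave β' (2 * β') α' (θ.toLinearEquiv.symm z)
    simp only at key
    rw [← hz] at key
    constructor
    · intro hz0
      rw [hz0] at key
      have : substQ K β' 0 (h.sharp E (θ.toLinearEquiv.symm z)) = substQ K β' 0 0 := by rw [key, map_zero]
      exact (substEquiv K β' 0).injective this
    · intro hz0
      rw [hz0, map_zero] at key
      exact key.symm
  have hfin : Module.finrank K (LinearMap.ker (h.sharp E)) = Module.finrank K (LinearMap.ker (wavePert K p r ρ)) := by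
    rw [hkerP, LinearEquiv.finrank_map_eq]
  rw [hfin]
  -- the perturbation estimates
  have hω : ∀ i : Fin 2, 1 ≤ unitWeight i := fun i => by simp
  have hC2 : (Ideal.Quotient.mk (boxIdeal (Fin 2) K (p ^ 1)) (C (2 * β'))) = 2 * Ideal.Quotient.mk _ (C β') := by
    rw [two_mul, C_add, RingHom.map_add, two_mul]
  have hCδ : (Ideal.Quotient.mk (boxIdeal (Fin 2) K (p ^ 1)) (C δ)) =
      Ideal.Quotient.mk _ (C α') - Ideal.Quotient.mk _ (C β') ^ 2 := by
    rw [hδ, C_sub, C_pow, RingHom.map_sub, RingHom.map_pow]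
  have hr1 : r ∈ wdegIdeal K 2 (p ^ 1) unitWeight 1 := by
    have h1' := h.substQ_tau_sub_C_mem hp2 β' 0 unitWeight hω (2 * β')
    rw [hC2] at h1'
    rw [hr]; exact h1'
  have hρ1 : ρ - Ideal.Quotient.mk _ (C δ) ∈ wdegIdeal K 2 (p ^ 1) unitWeight 1 := by
    have h1' := h.substQ_tau_sub_C_mem hp2 β' 0 unitWeight hω (2 * β')
    have h2' := h.substQ_tau_sub_C_mem hp2 β' 0 unitWeight hω α'
    rw [hC2] at h1'
    have : ρ - Ideal.Quotient.mk _ (C δ) =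
        -(Ideal.Quotient.mk _ (C β')) * (substQ K β' 0 (h.tau (2 * β')) - 2 * Ideal.Quotient.mk _ (C β')) +
          (substQ K β' 0 (h.tau α') - Ideal.Quotient.mk _ (C α')) := by
      rw [hρ, hCδ]
      ring
    rw [this]
    exact Submodule.add_mem _ (Ideal.mul_mem_left _ _ h1') h2'
  exact finrank_ker_wavePert_le hp2 hδ0 hr1 hρ1

end Wave

end Summit.ResolutionOfSingularities.KangarooAtlas.Mizutani
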